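import Mathlib
import Literature.MathematicalPhysics.QuantumFieldTheory.MagnenRivasseauSeneor1993.MRS93AxialYMAction
import Literature.MathematicalPhysics.QuantumFieldTheory.MagnenRivasseauSeneor1993.MRS93CountertermScaling
import HarnessLib

/-!
# Magnen–Rivasseau–Sénéor (CMP 155, 1993): the GAUGE-RESTORING COUNTERTERM FUNCTIONAL `CT_ρ` of (III.1) — the four
# operators `A², A⁴, A(−Δ)A, (∂A)²` of p.347 and `F₄` — and the factor `e^{CT_ρ(A′)}` of the bare ansatz (II.78),
# typed CONCRETELY on cut-off configurations of the pinned momentum-lattice carrier; bookkeeping PROVED: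
# «traces are definite negative» (the four operators are `≥ 0`), `F₂ = A(−Δ)A − (∂A)²` (hence `(∂A)² ≤ A(−Δ)A`),
# `(∫_Λ A²)² ≤ ∫_Λ A⁴` for a real field, the sign/boundedness of `e^{CT_ρ}` under nonnegative coefficients, and the
# global `SU(2)` (colour-rotation) invariance of the four new operators (p.347 tl.19–22), of `F₄`, of the action (II.2)
# and of `CT_ρ` KERNEL-CHECKED (v1.1: `SO(3)`-equivariance of the printed wedge product)

statement-level skeleton of published definitions with citation tags; bookkeeping proved; nothing here is a claim
about the Yang–Mills mass gap, about continuum Yang–Mills on `T⁴` without infrared cutoff, or about the Clay problem —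
and nothing of Magnen–Rivasseau–Sénéor's analysis is asserted or formalised

**Citation header (reproduction of PUBLISHED work).** J. Magnen, V. Rivasseau, R. Sénéor, *Construction of YM₄ with
an infrared cutoff*, Commun. Math. Phys. **155** (1993) 325–383 [MagnenRivasseauSeneor1993], Sect. III p.347
((III.1) and the paragraphs tl.16–35 around it) with Lemma III.1 (III.2) p.348, and (II.78) p.347 tl.2–7 (second line,
factor `e^{CT_ρ(A′)}`). Loci `p.NNN tl.nn` = journal page / text-layer line of the held scan
`paper:magnen1993-cmp155-mrs-ym4-infrared-cutoff` (PDF page = journal page − 324); the displays (II.78), (III.1),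
(III.2) were read on the decoded page images (renders of record `run/shared/lean/pub/lit-balaban/inprint/
lit-balaban-p14/renders-cmp155/p23_full_s6.png`, `p24_full_s6.png`). Cell pub-balaban-gaps, track G3, seat mrs-lit-1
(gen 5); companion prose `run/shared/lean/pub/pub-balaban-gaps/g3/MRS-AS-PRINTED.md` §2, §5. Builds on
`…MRS93AxialYMAction` (seat mrs-lit-1: `coeff`, `coeffZ`, windows, `convSupport`, `quadForm`, `linCurv`, `F2`, `F4`,
READING (P)) and `…MRS93CountertermScaling` (seat mrs-lit-2: the coefficient data `Counterterms.CountertermFamily` of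
(III.1) and Lemma III.1 as typed predicates; its docstring: «Only the COEFFICIENTS are carried — the operators `A⁴, A²,
A(−Δ)A, (∂A)², F₄` belong to the statement layer» — this file supplies them).

**Why this file.** Of the eleven factors of the bare ansatz (II.78) the tree types the two Gaussian reference measures
(`muZero`, `muZeroPrime`, `nu`), the axial Yang–Mills action factor (`ymFactor`) and the true-cutoff tilt; the record
of this seat listed `e^{CT_ρ(A′)}` among the factors «not definition-complete in print (b_ρ by fixed point; (III.2)
asymptotic)». That is true of its five COEFFICIENTS only: the FORM (III.1) is definition-complete — five explicit
local functionals of the field —, so the factor is typed here exactly as the print leaves it: a genuine function of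
the cut-off configuration and of five real numbers `a_ρ, b_ρ, c_ρ, d_ρ, e_ρ` (named binders, mrs-lit-2's
`CountertermFamily`), about which the print asserts (III.2) (typed there as `LemmaIII1ScalingPrinted`) and nothing
closed-form.

**What the paper prints (verbatim, from the page images).**
* p.347 tl.2–7, (II.78) second line: *«× e^{−(1/2)⟨A′,[(κ_ρ)⁻¹−1](p²)A′⟩} e^{CT_ρ(A′)}»*; tl.8–11: *«This functional
  integral is now similar in the first orders of perturbation theory to the ordinary functional integral with
  ultraviolet cutoff κ_ρ(p) both on the field and ghosts propagator. In these conditions it is easy to compute the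
  counterterms CT_ρ(A′) which restore Slavnov identities. We show now how to perform this task.»*
* p.347 tl.16–18: *«The computation of the gauge variant counterterms which restore Ward identities is made in terms
  of the field A′. For this computation we can assume that A′ = A′_s and B′_l = 0. Furthermore in this section we
  write A for simplicity instead of A′.»*
* p.347 tl.19–27: *«Our ultraviolet cutoff does not break global SU(2) or Euclidean invariance (small Euclidean
  breaking effects nevertheless occur due to the infrared cutoff; for instance in the case of a torus there exist
  such effects due to the lattice structure of Λ*, but they are tied to the unit scale and do not need
  counterterms). Therefore the only new relevant or marginal operators that we should consider are − Tr A_μA_μ,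
  (− Tr A_μA_μ)², (− Tr A_μ(−Δ)A_μ) and − Tr(∂_μA_μ)² which we abbreviate respectively as A², A⁴, A(−Δ)A and (∂A)²
  (recall the convention that traces are definite negative). This is only true for the SU(2) theory, for an SU(N)
  theory there would be a longer list of operators to consider and the analysis would be more complicated.»*
* p.347 tl.28–35: *«In fact our gauge breaking cutoff also disturbs the magic relation Z₂Z₄ = Z₃² which relates the
  multiplicative renormalization of F₂, F₃ and F₄ in F² and expresses the fact that up to a rescaling of A only the
  coupling constant λ is renormalized [IZ]. To correct this problem, using the possibility of rescaling A, we need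
  only to introduce a single counterterm, for instance of the type F₄. Therefore the counterterms that we introduce
  are: e^{CT} = e^{−a_ρ∫_Λ(A⁴/4!) − b_ρ∫_Λ(A²/2!) − c_ρ∫_Λ(A(−Δ)A) − d_ρ∫_Λ(∂A)² − e_ρ∫_Λ F₄}. (III.1)»*
* p.347 tl.36–40: *«The relevant counterterm b_ρ∫_Λ(A²/2) must be fine tuned exactly to have a renormalized mass
  which is zero. This is the same problem as fixing the critical bare mass in infrared φ⁴₄ [FMRS1], [R] and should
  be solved by a fixed point argument as in [R] …»*; p.348 tl.5–8, Lemma III.1: *«a_ρ ≅ aλ_ρ⁴, b_ρ ≅ bM^{2ρ}λ_ρ², c_ρ ≅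
  cλ_ρ², d_ρ ≅ dλ_ρ², e_ρ ≅ eλ_ρ⁴. (III.2) Furthermore by choosing the cutoff of the form (II.14) with η small enough
  (depending on the shape of τ), the coefficient a is strictly positive.»*
* p.328 tl.26–29 and tl.37–41 (conventions, as in `…AxialYMAction`): *«A = Σ_a A^a t_a, with t_a = (iσ_a/2) … We have
  Tr t_a t_b = −δ_ab/2»*; *«⟨A, B⟩ … minus a trace over group indices, so that it is positive definite with a factor
  1/2 in component notation. We also write simply A² for ⟨A, A⟩»*.

**What is typed here (definitions with bodies; bookkeeping kernel-checked, zero `sorry`, zero named facts).**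
* §1 the four operators of p.347 tl.22–25 as functionals of the cut-off field on a momentum window `S` (READING (P)
  of `…AxialYMAction`: Parseval at unit volume, `∂_μ ↔ ip_μ`, products = convolutions; `−Tr t_at_b = δ_ab/2` gives
  the «factor 1/2 in component notation»): `opA2 S A = ∫_Λ A² = (1/2)Σ_p Σ_{μ,a}|Ã^a_μ(p)|²` (= `⟨A, A⟩`, the tree's
  `quadForm S 1`, as p.328 «A² for ⟨A, A⟩» demands — `opA2_eq_quadForm`), `opALapA S A = ∫_Λ A(−Δ)A = ⟨A, p²A⟩`,
  `opDivSq S A = ∫_Λ (∂A)² = (1/2)Σ_p Σ_a |Σ_μ p_μ Ã^a_μ(p)|²`, the Fourier coefficient `sqDensity S A k = (A²)~(k) =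
  (1/2)Σ_{q+r=k} Σ_{μ,a} Ã^a_μ(q)Ã^a_μ(r)` of the density `A²(x) = −Tr A_μ(x)A_μ(x)` and `opA4 S A = ∫_Λ A⁴ = Σ_k |(A²)~(k)|²`;
  `F₄` is the tree's `F4` (the `λ²` piece of the action (II.2)/(II.3), READING (Q′) below).
* §2 PROVED: «traces are definite negative» — `opA2_nonneg`, `opALapA_nonneg`, `opDivSq_nonneg`, `opA4_nonneg` (and
  the tree's `F4_nonneg`); the transversality identity **`F2_eq_opALapA_sub_opDivSq`**: the quadratic piece `F₂` of
  the action (II.3) IS `∫_Λ A(−Δ)A − ∫_Λ (∂A)²` (mode by mode `Σ_{μν}|p_μÃ_ν − p_νÃ_μ|² = 2(|p|²|Ã|² − |p·Ã|²)`), whence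
  **`opDivSq_le_opALapA`** (`(∂A)² ≤ A(−Δ)A`, i.e. `F₂ ≥ 0`); `sqDensity_zero` (for a REAL field on a symmetric window
  the zero mode of the density `A²` is `∫_Λ A²`) and **`opA2_sq_le_opA4`** (`(∫_Λ A²)² ≤ ∫_Λ A⁴` — Jensen at unit
  volume, here: one term of a Parseval sum); `coeff_realify_neg` (every realified configuration — the support of all
  the typed Gaussian measures — is a real field: `Ã(−p) = conj Ã(p)`).
* §3 **(III.1)**: `counterterm cf ρ S A = CT_ρ(A) = −a_ρ∫_Λ A⁴/4! − b_ρ∫_Λ A²/2! − c_ρ∫_Λ A(−Δ)A − d_ρ∫_Λ (∂A)² − e_ρ∫_Λ F₄`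
  with the coefficients drawn from `cf : Counterterms.CountertermFamily` (mrs-lit-2) at the ultraviolet index `ρ`, and
  the (II.78) factor `ctFactor cf ρ S A = e^{CT_ρ(A)}`: positive, continuous, measurable; with all five coefficients
  `≥ 0` at `ρ` the exponent is `≤ 0` and the factor `≤ 1` (`counterterm_nonpos`, `ctFactor_le_one`), hence integrable
  against every finite measure on configurations, in particular against the reference measure `dμ_{0,ρ₁}(A′)` of
  (II.78) (`integrable_ctFactor_muZeroPrime`); `Parameters.countertermFamily` binds `λ_ρ` of the family to the named
  bare coupling (II.11) of the pinned parameters (`λ_ρ = (λ_ρ²)^{1/2}`).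
* §4 p.347 tl.19–22 «Our ultraviolet cutoff does not break global SU(2) … invariance» — the premise under which only
  invariant operators are listed — KERNEL-CHECKED for the four NEW operators: under a global colour rotation
  `(R·A)^a_μ(p) = Σ_c R_ac A^c_μ(p)` with `Rᵀ R = 1` (in particular `R ∈ SO(3)`, the adjoint image of a constant
  `g ∈ SU(2)`, (II.4) with `∂g = 0`), `∫_Λ A²`, `∫_Λ A(−Δ)A`, `∫_Λ (∂A)²`, `(A²)~(k)` and `∫_Λ A⁴` are unchanged
  (`opA2_colourRotate`, `opALapA_colourRotate`, `opDivSq_colourRotate`, `sqDensity_colourRotate`, `opA4_colourRotate`,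
  `ops_invariant_of_mem_specialOrthogonalGroup`; engine `sum_rotate_mul_rotate`: `Σ_a (Rz)_a (Rw)_a = Σ_c z_c w_c`).
* §5 (v1.1) the remaining piece: the printed wedge product is `SO(3)`-EQUIVARIANT (`cross_rotVec`: the cofactor
  identity `(Rz) ×₃ (Rw) = (adj R)ᵀ(z ×₃ w)` for every real `R`, Mathlib `Matrix.adjugate_fin_three`; `cross_rotVec_SO`:
  `= R(z ×₃ w)` when `RᵀR = 1`, `det R = 1`), hence `quadCurv`, `curvCoeff` rotate as colour vectors and
  **`action_colourRotate`** (the cut-off action (II.2) is invariant under constant `SO(3)` rotations — p.329 tl.4 for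
  the global transformations, exactly), **`F4_colourRotate`**, **`counterterm_colourRotate`** /
  `ctFactor_colourRotate_of_mem_specialOrthogonalGroup` (all of (III.1) and the factor `e^{CT_ρ}` are invariant).

**Readings (declared).** (P), (S) of `…AxialYMAction` (Parseval at unit volume; finite windows — the canonical one
under `dμ_{0,ρ₁}(A′)` is `window((3 + η⁻¹)M^{ρ₁})`, every statement holds for every `S`). (Q′) «∫_Λ F₄» of (III.1) =
the `λ²` coefficient of the ACTION `(1/2)∫_Λ F²` of (II.2)/(II.3), i.e. the tree's `F4` — the same identification as
READING (Q) there («F²» = the action); read with «F²» = `⟨F, F⟩` it would be `2·F4`, a factor the coefficient `e_ρ`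
absorbs. (W) `∫_Λ A⁴ = ∫_Λ (A²(x))² d⁴x` is typed as `Σ_k |(A²)~(k)|²`, which is `∫_Λ |A²(x)|²`: the same number for a
real field (then `A²(x)` is real), the natural extension to all of `Config` otherwise (as `action` uses `|F̃|²`).
(X) The twelve-component field: (III.1) is written for `A′` («we write A for simplicity instead of A′»), which has
time components; `Config` carries all four Lorentz indices, so the functionals apply to `A′` verbatim and to the
nine-component axial `A` by restriction.

**Honest status / what is NOT claimed.** `CT_ρ` is typed as a FUNCTION of five coefficient binders; the print gives
the coefficients only through (III.2) (asymptotic, one loop; `c, d, e` «left to the reader») and `b_ρ` only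
implicitly (fixed point «as in [R]», not carried out in print) — none is constructed here, (III.2) is not proved here
(it is mrs-lit-2's typed predicate), and the sign hypotheses of §3 are hypotheses (the print asserts `a > 0` for
small `η`, Lemma III.1, and is silent on the signs of `b, c, d, e`). Not typed: the Feynman rules and graphs of
pp.348–352 (their arithmetic is the tree's `MRS93OneLoopCounterterms.lean`), the Slavnov identities the counterterms
restore, the «magic relation Z₂Z₄ = Z₃²», the (lattice-)Euclidean invariance of the operators (not kernel-checked;
§4/§5 cover the global `SU(2)` invariance of all five operators and of the action), the COMPLETENESS claim
«the only new relevant or marginal operators» (a classification of invariant local monomials of dimension ≤ 4, not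
attempted), and every other factor of (II.78) (`χ_LFR`, `G(A′,γ)` (II.45), `K_{ρ,ρ₂}` (II.76), `L_{0,ρ₁}F`,
the γ-damping — see the seat record for the printed reasons). Nothing here makes (II.78) normalisable; nothing is
continuum Yang–Mills on `T⁴` without infrared cutoff, a mass gap, or Clay; nothing of Bałaban's is touched.
-/

noncomputable section

open MeasureTheory Finset Complex
open scoped NNReal ENNReal ComplexConjugate Matrix

namespace Literature.MathematicalPhysics.QuantumFieldTheory.MagnenRivasseauSeneor1993

namespace MainStatement

open Ansatz Counterterms

variable (S : Finset Momentum)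

/-! ## §1 The four operators of p.347: `A²`, `A(−Δ)A`, `(∂A)²`, `A⁴` on a momentum window -/

/-- **`∫_Λ A²`** — the operator «− Tr A_μA_μ» abbreviated «A²» (p.347 tl.22–25), integrated over the torus: with
`−Tr t_at_b = δ_ab/2` and Parseval at unit volume (READING (P)), `(1/2) Σ_{p∈S} Σ_{μ,a} |Ã^a_μ(p)|²` — which is the
scalar product `⟨A, A⟩` of p.328 («We also write simply A² for ⟨A, A⟩»), the tree's `quadForm S 1`.
[cite: MagnenRivasseauSeneor1993, §III p.347 tl.22–25; §II.A p.328 tl.37–41] -/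
def opA2 (A : Config) : ℝ := quadForm S (fun _ => 1) A

/-- **`∫_Λ A(−Δ)A`** — the operator «(− Tr A_μ(−Δ)A_μ)» abbreviated «A(−Δ)A» (p.347 tl.22–25): `−Δ ↔ |p|²`
(READING (P)), so it is the quadratic form `⟨A, p²A⟩ = (1/2) Σ_{p∈S} |p|² Σ_{μ,a} |Ã^a_μ(p)|²`.
[cite: MagnenRivasseauSeneor1993, §III p.347 tl.22–25] -/
def opALapA (A : Config) : ℝ := quadForm S (fun p => p.norm ^ 2) A

/-- **`∫_Λ (∂A)²`** — the operator «− Tr(∂_μA_μ)²» abbreviated «(∂A)²» (p.347 tl.22–25): `(∂_μA_μ)~(p) = i Σ_μ p_μ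
Ã_μ(p)` (READING (P)), so it is `(1/2) Σ_{p∈S} Σ_a |Σ_μ p_μ Ã^a_μ(p)|²`.
[cite: MagnenRivasseauSeneor1993, §III p.347 tl.22–25] -/
def opDivSq (A : Config) : ℝ :=
  (1 / 2) * ∑ p ∈ S, ∑ a, normSq (∑ μ, ((p.1 μ : ℤ) : ℂ) * coeff A p μ a)

/-- The Fourier coefficient `(A²)~(k)` of the DENSITY `A²(x) = −Tr A_μ(x)A_μ(x) = (1/2)Σ_{μ,a}(A^a_μ(x))²` of the
cut-off field: the convolution `(1/2) Σ_{q,r∈S, q+r=k} Σ_{μ,a} Ã^a_μ(q) Ã^a_μ(r)` (READING (P)).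
[cite: MagnenRivasseauSeneor1993, §III p.347 tl.22–25; §II.A p.328 tl.26–29] -/
def sqDensity (A : Config) (k : Fin 4 → ℤ) : ℂ :=
  (1 / 2) * ∑ q ∈ S, ∑ r ∈ S, if q.1 + r.1 = k then ∑ μ, ∑ a, coeff A q μ a * coeff A r μ a else 0

/-- **`∫_Λ A⁴`** — the operator «(− Tr A_μA_μ)²» abbreviated «A⁴» (p.347 tl.22–25), integrated over the torus: by
Parseval at unit volume `Σ_k |(A²)~(k)|²`, the sum running over the support `S₀ + S₀` of the convolution (READINGS
(P), (W)). [cite: MagnenRivasseauSeneor1993, §III p.347 tl.22–25] -/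
def opA4 (A : Config) : ℝ := ∑ k ∈ convSupport S, normSq (sqDensity S A k)

/-- `∫_Λ A² = ⟨A, A⟩` (p.328 «We also write simply A² for ⟨A, A⟩»): the tree's `quadForm S 1`.
[cite: MagnenRivasseauSeneor1993, §II.A p.328 tl.41, §III p.347 tl.25] -/
theorem opA2_eq_quadForm (A : Config) : opA2 S A = quadForm S (fun _ => 1) A := rfl

/-- `∫_Λ A²` written out: `(1/2) Σ_{p∈S} Σ_{μ,a} |Ã^a_μ(p)|²`. [cite: MagnenRivasseauSeneor1993, §III p.347 tl.22–25] -/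
theorem opA2_eq (A : Config) : opA2 S A = (1 / 2) * ∑ p ∈ S, ∑ μ, ∑ a, normSq (coeff A p μ a) := by
  unfold opA2 quadForm
  simp only [one_mul]

/-- `∫_Λ A(−Δ)A = ⟨A, p²A⟩`: the tree's `quadForm S (|p|²)`. [cite: MagnenRivasseauSeneor1993, §III p.347 tl.22–25] -/
theorem opALapA_eq_quadForm (A : Config) : opALapA S A = quadForm S (fun p => p.norm ^ 2) A := rfl

/-! ## §2 «traces are definite negative»; `F₂ = A(−Δ)A − (∂A)²`; `(∫A²)² ≤ ∫A⁴` for a real field -/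

/-- `∫_Λ A² ≥ 0` («recall the convention that traces are definite negative», p.347 tl.25).
[cite: MagnenRivasseauSeneor1993, §III p.347 tl.25] -/
theorem opA2_nonneg (A : Config) : 0 ≤ opA2 S A := quadForm_nonneg S (fun _ _ => zero_le_one) A

/-- `∫_Λ A(−Δ)A ≥ 0`. [cite: MagnenRivasseauSeneor1993, §III p.347 tl.25] -/
theorem opALapA_nonneg (A : Config) : 0 ≤ opALapA S A := quadForm_nonneg S (fun p _ => sq_nonneg p.norm) A

/-- `∫_Λ (∂A)² ≥ 0`. [cite: MagnenRivasseauSeneor1993, §III p.347 tl.25] -/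
theorem opDivSq_nonneg (A : Config) : 0 ≤ opDivSq S A := by
  unfold opDivSq
  exact mul_nonneg (by norm_num) (sum_nonneg fun p _ => sum_nonneg fun a _ => normSq_nonneg _)

/-- `∫_Λ A⁴ ≥ 0`. [cite: MagnenRivasseauSeneor1993, §III p.347 tl.25] -/
theorem opA4_nonneg (A : Config) : 0 ≤ opA4 S A := sum_nonneg fun _ _ => normSq_nonneg _

/-- Mode by mode: `Σ_{μ,ν} |i(p_μ z_ν − p_ν z_μ)|² = 2|p|²Σ_ν|z_ν|² − 2|Σ_μ p_μ z_μ|²` for a real (lattice) momentum `p`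
and a complex vector `z` — the algebra behind `(∂∧A)² = A(−Δ)A − (∂A)²`. [cite: MagnenRivasseauSeneor1993, (II.3) p.329, §III p.347 tl.22–25] -/
theorem sum_normSq_wedge (p : Fin 4 → ℤ) (z : Fin 4 → ℂ) :
    ∑ μ, ∑ ν, normSq (I * (((p μ : ℤ) : ℂ) * z ν - ((p ν : ℤ) : ℂ) * z μ)) =
      2 * (∑ μ, ((p μ : ℤ) : ℝ) ^ 2) * (∑ ν, normSq (z ν)) - 2 * normSq (∑ μ, ((p μ : ℤ) : ℂ) * z μ) := by
  simp only [Fin.sum_univ_four, Complex.normSq_apply, Complex.mul_re, Complex.mul_im, Complex.sub_re,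
    Complex.sub_im, Complex.add_re, Complex.add_im, Complex.I_re, Complex.I_im, Complex.intCast_re,
    Complex.intCast_im]
  ring

/-- **`F₂ = ∫_Λ A(−Δ)A − ∫_Λ (∂A)²`**: the quadratic piece of the Yang–Mills action (II.3) (the tree's `F2`,
`(1/4)Σ|(∂∧A)~|²`) is the difference of two of the operators of (III.1) — the free action is transverse.
[cite: MagnenRivasseauSeneor1993, (II.3) p.329 tl.2–3, §III p.347 tl.22–25] -/
theorem F2_eq_opALapA_sub_opDivSq (A : Config) : F2 S A = opALapA S A - opDivSq S A := by
  set g : (Fin 4 → ℤ) → (Fin 4 → Fin 3 → ℂ) → ℝ := fun k c =>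
    ∑ μ, ∑ ν, ∑ a, normSq (I * (((k μ : ℤ) : ℂ) * c ν a - ((k ν : ℤ) : ℂ) * c μ a)) with hg
  have hF2 : F2 S A = (1 / 4) * ∑ k ∈ convSupport S, g k (coeffZ S A k) := rfl
  rw [hF2, sum_convSupport_coeffZ S A g (fun _ => by simp [hg])]
  simp only [hg]
  have hmode : ∀ p ∈ S, (∑ μ : Fin 4, ∑ ν : Fin 4, ∑ a : Fin 3,
      normSq (I * (((p.1 μ : ℤ) : ℂ) * coeff A p ν a - ((p.1 ν : ℤ) : ℂ) * coeff A p μ a))) =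
      2 * p.norm ^ 2 * (∑ μ : Fin 4, ∑ a : Fin 3, normSq (coeff A p μ a)) -
        2 * ∑ a : Fin 3, normSq (∑ μ : Fin 4, ((p.1 μ : ℤ) : ℂ) * coeff A p μ a) := by
    intro p _
    have hswap : (∑ μ : Fin 4, ∑ ν : Fin 4, ∑ a : Fin 3,
        normSq (I * (((p.1 μ : ℤ) : ℂ) * coeff A p ν a - ((p.1 ν : ℤ) : ℂ) * coeff A p μ a))) =
        ∑ a : Fin 3, ∑ μ : Fin 4, ∑ ν : Fin 4,
          normSq (I * (((p.1 μ : ℤ) : ℂ) * coeff A p ν a - ((p.1 ν : ℤ) : ℂ) * coeff A p μ a)) := by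
      exact (Finset.sum_congr rfl fun μ _ => Finset.sum_comm).trans Finset.sum_comm
    rw [hswap]
    simp_rw [sum_normSq_wedge (p.1) (fun ρ => coeff A p ρ _)]
    rw [Finset.sum_sub_distrib, ← Finset.mul_sum, ← Finset.mul_sum, Momentum.norm_sq, Finset.sum_comm]
  rw [Finset.sum_congr rfl hmode]
  unfold opALapA quadForm opDivSq
  rw [Finset.sum_sub_distrib, mul_sub, Finset.mul_sum, Finset.mul_sum, Finset.mul_sum, Finset.mul_sum]
  congr 1
  · exact Finset.sum_congr rfl fun p _ => by ring
  · exact Finset.sum_congr rfl fun p _ => by ring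

/-- Hence **`∫_Λ (∂A)² ≤ ∫_Λ A(−Δ)A`** on every window (`F₂ ≥ 0`). [cite: MagnenRivasseauSeneor1993, (II.3) p.329, §III p.347 tl.22–25] -/
theorem opDivSq_le_opALapA (A : Config) : opDivSq S A ≤ opALapA S A := by
  have h := F2_nonneg S A
  rw [F2_eq_opALapA_sub_opDivSq] at h
  linarith

/-- The zero momentum is in the support `S₀ + S₀` of the convolutions. [cite: MagnenRivasseauSeneor1993, §II.A p.328 tl.12–15] -/
theorem zero_mem_convSupport : (0 : Fin 4 → ℤ) ∈ convSupport S := by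
  unfold convSupport
  exact Finset.mem_image₂.mpr ⟨0, Finset.mem_insert_self _ _, 0, Finset.mem_insert_self _ _, add_zero 0⟩

/-- REALITY of the realified configurations (the support of every typed Gaussian measure of the tree: `muZero`,
`muZeroPrime`, `muAxial`): `Ã^a_μ(−p) = conj Ã^a_μ(p)`. [cite: MagnenRivasseauSeneor1993, §II.A p.328 tl.12–17] -/
theorem coeff_realify_neg (X : Config) (p : Momentum) (μ : Fin 4) (a : Fin 3) :
    coeff (realify modeIm X) p.neg μ a = conj (coeff (realify modeIm X) p μ a) := by
  unfold coeff realify sgn rep modeIm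
  rcases Momentum.isPos_or_isPos_neg p with hp | hp
  · have hn : ¬ p.neg.IsPos := Momentum.not_isPos_neg_of_isPos hp
    apply Complex.ext <;> simp [hp, hn, Momentum.neg_neg]
  · have hn : ¬ p.IsPos := fun h => Momentum.not_isPos_neg_of_isPos h hp
    apply Complex.ext <;> simp [hp, hn]

/-- For a REAL field (`Ã(−p) = conj Ã(p)`) on a window closed under `p ↦ −p`, the zero mode of the density `A²` is
its integral: `(A²)~(0) = ∫_Λ A² = (1/2)Σ_p Σ_{μ,a}|Ã^a_μ(p)|²` (the pair `(q, −q)` is the only one summing to `0`).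
[cite: MagnenRivasseauSeneor1993, §III p.347 tl.22–25; §II.A p.328 tl.12–17] -/
theorem sqDensity_zero {S : Finset Momentum} (hS : ∀ p ∈ S, p.neg ∈ S) {A : Config}
    (hA : ∀ p ∈ S, ∀ μ a, coeff A p.neg μ a = conj (coeff A p μ a)) :
    sqDensity S A 0 = ((opA2 S A : ℝ) : ℂ) := by
  rw [opA2_eq]
  unfold sqDensity
  push_cast
  congr 1
  refine Finset.sum_congr rfl fun q hq => ?_
  rw [Finset.sum_eq_single_of_mem q.neg (hS q hq)]
  · rw [if_pos]
    · refine Finset.sum_congr rfl fun μ _ => Finset.sum_congr rfl fun a _ => ?_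
      rw [hA q hq, Complex.mul_conj]
    · funext μ; simp
  · intro r _ hr
    rw [if_neg]
    intro h
    apply hr
    apply Subtype.ext
    funext μ
    have := congrFun h μ
    simp only [Pi.add_apply, Pi.zero_apply] at this
    simp only [Momentum.neg_apply]
    omega

/-- **`(∫_Λ A²)² ≤ ∫_Λ A⁴`** for a real field on a symmetric window — Jensen at unit volume, here one term (`k = 0`)
of the Parseval sum `Σ_k |(A²)~(k)|²`. [cite: MagnenRivasseauSeneor1993, §III p.347 tl.22–25] -/
theorem opA2_sq_le_opA4 {S : Finset Momentum} (hS : ∀ p ∈ S, p.neg ∈ S) {A : Config}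
    (hA : ∀ p ∈ S, ∀ μ a, coeff A p.neg μ a = conj (coeff A p μ a)) :
    opA2 S A ^ 2 ≤ opA4 S A := by
  have h0 : normSq (sqDensity S A 0) = opA2 S A ^ 2 := by
    rw [sqDensity_zero hS hA, normSq_ofReal, sq]
  rw [← h0]
  unfold opA4
  exact Finset.single_le_sum (fun k _ => normSq_nonneg (sqDensity S A k)) (zero_mem_convSupport S)

/-- The realified configurations satisfy the reality hypothesis of `sqDensity_zero`/`opA2_sq_le_opA4` on EVERY
window. [cite: MagnenRivasseauSeneor1993, §II.A p.328 tl.12–17] -/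
theorem opA2_sq_le_opA4_realify {S : Finset Momentum} (hS : ∀ p ∈ S, p.neg ∈ S) (X : Config) :
    opA2 S (realify modeIm X) ^ 2 ≤ opA4 S (realify modeIm X) :=
  opA2_sq_le_opA4 hS fun p _ μ a => coeff_realify_neg X p μ a

/-! ## §3 (III.1): the counterterm functional `CT_ρ` and the factor `e^{CT_ρ(A′)}` of (II.78) -/

/-- **(III.1), the COUNTERTERM FUNCTIONAL** `CT_ρ(A) = −a_ρ∫_Λ(A⁴/4!) − b_ρ∫_Λ(A²/2!) − c_ρ∫_Λ(A(−Δ)A) − d_ρ∫_Λ(∂A)² −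
e_ρ∫_Λ F₄` of the cut-off field on the window `S`, the five coefficients taken from the family `cf` (mrs-lit-2's
`Counterterms.CountertermFamily`) at the ultraviolet index `ρ`; `∫_Λ F₄` = the tree's `F4` (READING (Q′)).
[cite: MagnenRivasseauSeneor1993, §III (III.1) p.347] -/
def counterterm (cf : CountertermFamily) (ρ : ℕ) (A : Config) : ℝ :=
  -(cf.a ρ * (opA4 S A / 24) + cf.b ρ * (opA2 S A / 2) + cf.c ρ * opALapA S A + cf.d ρ * opDivSq S A +
    cf.e ρ * F4 S A)

/-- **The factor `e^{CT_ρ(A′)}` of the bare ansatz (II.78)** (second line, p.347 tl.2–7), a genuine function of the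
cut-off configuration. [cite: MagnenRivasseauSeneor1993, (II.78) p.347 tl.2–7, (III.1) p.347] -/
def ctFactor (cf : CountertermFamily) (ρ : ℕ) (A : Config) : ℝ := Real.exp (counterterm S cf ρ A)

/-- (III.1) unfolded with `4! = 24`, `2! = 2`. [cite: MagnenRivasseauSeneor1993, §III (III.1) p.347] -/
theorem counterterm_eq (cf : CountertermFamily) (ρ : ℕ) (A : Config) :
    counterterm S cf ρ A = -(cf.a ρ * (opA4 S A / Nat.factorial 4) + cf.b ρ * (opA2 S A / Nat.factorial 2) +
      cf.c ρ * opALapA S A + cf.d ρ * opDivSq S A + cf.e ρ * F4 S A) := by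
  unfold counterterm
  norm_num [Nat.factorial]

/-- `e^{CT_ρ} > 0`. [cite: MagnenRivasseauSeneor1993, (III.1) p.347] -/
theorem ctFactor_pos (cf : CountertermFamily) (ρ : ℕ) (A : Config) : 0 < ctFactor S cf ρ A := Real.exp_pos _

/-- With all five coefficients nonnegative at `ρ` (the print: `a > 0` for small `η`, Lemma III.1; the signs of
`b, c, d, e` are not printed — hypotheses), `CT_ρ(A) ≤ 0`: every operator in (III.1) is `≥ 0`.
[cite: MagnenRivasseauSeneor1993, §III (III.1) p.347, Lemma III.1 p.348] -/
theorem counterterm_nonpos {cf : CountertermFamily} {ρ : ℕ} (ha : 0 ≤ cf.a ρ) (hb : 0 ≤ cf.b ρ)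
    (hc : 0 ≤ cf.c ρ) (hd : 0 ≤ cf.d ρ) (he : 0 ≤ cf.e ρ) (A : Config) : counterterm S cf ρ A ≤ 0 := by
  unfold counterterm
  have h1 := opA4_nonneg S A
  have h2 := opA2_nonneg S A
  have h3 := opALapA_nonneg S A
  have h4 := opDivSq_nonneg S A
  have h5 := F4_nonneg S A
  have : 0 ≤ cf.a ρ * (opA4 S A / 24) + cf.b ρ * (opA2 S A / 2) + cf.c ρ * opALapA S A + cf.d ρ * opDivSq S A +
      cf.e ρ * F4 S A := by positivity
  linarith

/-- … and then `0 < e^{CT_ρ(A)} ≤ 1`: the counterterm factor is a bounded density.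
[cite: MagnenRivasseauSeneor1993, (II.78) p.347, (III.1) p.347] -/
theorem ctFactor_le_one {cf : CountertermFamily} {ρ : ℕ} (ha : 0 ≤ cf.a ρ) (hb : 0 ≤ cf.b ρ) (hc : 0 ≤ cf.c ρ)
    (hd : 0 ≤ cf.d ρ) (he : 0 ≤ cf.e ρ) (A : Config) : ctFactor S cf ρ A ≤ 1 :=
  Real.exp_le_one_iff.mpr (counterterm_nonpos S ha hb hc hd he A)

/-- `∫_Λ A²`, `∫_Λ A(−Δ)A` are continuous on configurations (quadratic forms of finitely many coordinates).
[cite: MagnenRivasseauSeneor1993, §III p.347 tl.22–25] -/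
theorem continuous_opA2 : Continuous fun A : Config => opA2 S A := continuous_quadForm S _

/-- See `continuous_opA2`. [cite: MagnenRivasseauSeneor1993, §III p.347 tl.22–25] -/
theorem continuous_opALapA : Continuous fun A : Config => opALapA S A := continuous_quadForm S _

/-- `∫_Λ (∂A)²` is continuous. [cite: MagnenRivasseauSeneor1993, §III p.347 tl.22–25] -/
theorem continuous_opDivSq : Continuous fun A : Config => opDivSq S A := by
  unfold opDivSq
  refine continuous_const.mul (continuous_finsetSum _ fun p _ => continuous_finsetSum _ fun a _ => ?_)
  exact Complex.continuous_normSq.comp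
    (continuous_finsetSum _ fun μ _ => continuous_const.mul (continuous_coeff p μ a))

/-- `(A²)~(k)` is continuous. [cite: MagnenRivasseauSeneor1993, §III p.347 tl.22–25] -/
theorem continuous_sqDensity (k : Fin 4 → ℤ) : Continuous fun A : Config => sqDensity S A k := by
  unfold sqDensity
  refine continuous_const.mul (continuous_finsetSum _ fun q _ => continuous_finsetSum _ fun r _ => ?_)
  split_ifs
  · exact continuous_finsetSum _ fun μ _ => continuous_finsetSum _ fun a _ =>
      (continuous_coeff q μ a).mul (continuous_coeff r μ a)
  · exact continuous_const

/-- `∫_Λ A⁴` is continuous. [cite: MagnenRivasseauSeneor1993, §III p.347 tl.22–25] -/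
theorem continuous_opA4 : Continuous fun A : Config => opA4 S A := by
  unfold opA4
  exact continuous_finsetSum _ fun k _ => Complex.continuous_normSq.comp (continuous_sqDensity S k)

/-- `F₄` is continuous. [cite: MagnenRivasseauSeneor1993, (II.3) p.329] -/
theorem continuous_F4 : Continuous fun A : Config => F4 S A := by
  unfold F4
  exact continuous_const.mul (continuous_finsetSum _ fun k _ => continuous_finsetSum _ fun μ _ =>
    continuous_finsetSum _ fun ν _ => continuous_finsetSum _ fun a _ =>
      Complex.continuous_normSq.comp ((continuous_apply a).comp (continuous_quadCurv S μ ν k)))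

/-- `CT_ρ` is continuous on configurations. [cite: MagnenRivasseauSeneor1993, (III.1) p.347] -/
theorem continuous_counterterm (cf : CountertermFamily) (ρ : ℕ) :
    Continuous fun A : Config => counterterm S cf ρ A := by
  unfold counterterm
  refine Continuous.neg ?_
  refine ((((continuous_const.mul ((continuous_opA4 S).div_const _)).add
    (continuous_const.mul ((continuous_opA2 S).div_const _))).add
    (continuous_const.mul (continuous_opALapA S))).add
    (continuous_const.mul (continuous_opDivSq S))).add
    (continuous_const.mul (continuous_F4 S))

/-- `e^{CT_ρ}` is continuous, hence measurable — a legitimate density factor. [cite: MagnenRivasseauSeneor1993, (II.78) p.347, (III.1) p.347] -/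
theorem continuous_ctFactor (cf : CountertermFamily) (ρ : ℕ) : Continuous fun A : Config => ctFactor S cf ρ A :=
  Real.continuous_exp.comp (continuous_counterterm S cf ρ)

/-- Measurability of `e^{CT_ρ}`. [cite: MagnenRivasseauSeneor1993, (II.78) p.347, (III.1) p.347] -/
theorem measurable_ctFactor (cf : CountertermFamily) (ρ : ℕ) : Measurable fun A : Config => ctFactor S cf ρ A :=
  (continuous_ctFactor S cf ρ).measurable

/-- With nonnegative coefficients the bounded continuous factor `e^{CT_ρ}` is integrable against every finite measure
on configurations … [cite: MagnenRivasseauSeneor1993, (II.78) p.347, (III.1) p.347] -/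
theorem integrable_ctFactor {cf : CountertermFamily} {ρ : ℕ} (ha : 0 ≤ cf.a ρ) (hb : 0 ≤ cf.b ρ) (hc : 0 ≤ cf.c ρ)
    (hd : 0 ≤ cf.d ρ) (he : 0 ≤ cf.e ρ) (μ : Measure Config) [IsFiniteMeasure μ] :
    Integrable (fun A => ctFactor S cf ρ A) μ := by
  refine Integrable.of_bound (C := 1) (measurable_ctFactor S cf ρ).aestronglyMeasurable
    (Filter.Eventually.of_forall fun A => ?_)
  rw [Real.norm_eq_abs, abs_of_pos (ctFactor_pos S cf ρ A)]
  exact ctFactor_le_one S ha hb hc hd he A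

/-- … in particular against the reference Gaussian measure `dμ_{0,ρ₁}(A′)` of (II.78) on the twelve-component field
(the tree's `muZeroPrime`), for every window, every `ρ`, `ρ₁`. [cite: MagnenRivasseauSeneor1993, (II.78) p.347, (II.44) p.341] -/
theorem integrable_ctFactor_muZeroPrime (par : Parameters) {cf : CountertermFamily} {ρ : ℕ} (ha : 0 ≤ cf.a ρ)
    (hb : 0 ≤ cf.b ρ) (hc : 0 ≤ cf.c ρ) (hd : 0 ≤ cf.d ρ) (he : 0 ≤ cf.e ρ) (ρ₁ : ℕ) :
    Integrable (fun A => ctFactor S cf ρ A) (muZeroPrime par ρ₁) :=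
  integrable_ctFactor S ha hb hc hd he _

/-- The counterterm family OF THE PINNED PARAMETERS: the bare coupling `λ_ρ = (λ_ρ²)^{1/2}` from the named (II.11)
(`Parameters.bareCoupling`, which is `λ_ρ²`), the five coefficient sequences as binders (no closed form is printed:
(III.2) is asymptotic and `b_ρ` is fixed by a fixed-point condition, p.347 tl.36–40).
[cite: MagnenRivasseauSeneor1993, (II.11) p.330, (III.1) p.347, Lemma III.1 (III.2) p.348] -/
def Parameters.countertermFamily (par : Parameters) (a b c d e : ℕ → ℝ) : CountertermFamily where
  lamB ρ := Real.sqrt (par.bareCoupling ρ)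
  a := a
  b := b
  c := c
  d := d
  e := e

/-- Its `λ_ρ⁴` is the square of the named `λ_ρ²` wherever the latter is nonnegative (eventually, by
`Ansatz.bareCouplingSq_pos_eventually` under the printed sign `β₂ < 0`) — the normalisation in which (III.2) reads
`a_ρ ≅ a·(λ_ρ²)²`, `e_ρ ≅ e·(λ_ρ²)²`. [cite: MagnenRivasseauSeneor1993, (II.11) p.330, (III.2) p.348] -/
theorem Parameters.countertermFamily_lamB_pow_four (par : Parameters) (a b c d e : ℕ → ℝ) {ρ : ℕ}
    (h : 0 ≤ par.bareCoupling ρ) : (par.countertermFamily a b c d e).lamB ρ ^ 4 = par.bareCoupling ρ ^ 2 := by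
  show Real.sqrt (par.bareCoupling ρ) ^ 4 = _
  rw [show (4 : ℕ) = 2 * 2 from rfl, pow_mul, Real.sq_sqrt h]

/-! ## §4 «Our ultraviolet cutoff does not break global SU(2) … invariance» (p.347 tl.19–22): the four NEW operators
of (III.1) are invariant under global colour rotations (kernel-checked; `F₄`'s invariance — it is a piece of the
gauge-invariant `F²` — is not re-derived here) -/

/-- A GLOBAL (momentum-independent) rotation of the colour index of every coordinate by a real `3 × 3` matrix `R`:
`(R·A)^a_μ(p) = Σ_c R_ac A^c_μ(p)` — for `R ∈ SO(3)` the adjoint action of a constant `g ∈ SU(2)`, i.e. (II.4) with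
`∂_μ g = 0`. [cite: MagnenRivasseauSeneor1993, (II.4) p.329, §III p.347 tl.19–22] -/
def colourRotate (R : Matrix (Fin 3) (Fin 3) ℝ) (A : Config) : Config := fun m =>
  ∑ c, R m.2.2.1 c * A (m.1, m.2.1, c, m.2.2.2)

/-- On Fourier coefficients the rotation acts by the same real matrix: `(R·A)~^a_μ(p) = Σ_c R_ac Ã^c_μ(p)`.
[cite: MagnenRivasseauSeneor1993, (II.4) p.329, §III p.347 tl.19–22] -/
theorem coeff_colourRotate (R : Matrix (Fin 3) (Fin 3) ℝ) (A : Config) (p : Momentum) (μ : Fin 4) (a : Fin 3) :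
    coeff (colourRotate R A) p μ a = ∑ c, (R a c : ℂ) * coeff A p μ c := by
  unfold coeff colourRotate
  push_cast
  rw [Finset.sum_mul, ← Finset.sum_add_distrib]
  exact Finset.sum_congr rfl fun c _ => by ring

/-- The algebra of orthogonality: for `Rᵀ R = 1`, `Σ_a (Σ_c R_ac z_c)(Σ_d R_ad w_d) = Σ_c z_c w_c` (complex `z, w`).
[cite: MagnenRivasseauSeneor1993, §III p.347 tl.19–22] -/
theorem sum_rotate_mul_rotate {R : Matrix (Fin 3) (Fin 3) ℝ} (hR : Rᵀ * R = 1) (z w : Fin 3 → ℂ) :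
    ∑ a, (∑ c, (R a c : ℂ) * z c) * (∑ d, (R a d : ℂ) * w d) = ∑ c, z c * w c := by
  have hentry : ∀ c d : Fin 3, (∑ a, (R a c : ℂ) * (R a d : ℂ)) = if c = d then 1 else 0 := by
    intro c d
    have h := congrFun (congrFun hR c) d
    simp only [Matrix.mul_apply, Matrix.transpose_apply, Matrix.one_apply] at h
    have h' : (∑ a, (R a c : ℂ) * (R a d : ℂ)) = ((∑ a, R a c * R a d : ℝ) : ℂ) := by push_cast; rfl
    rw [h', h]
    split_ifs <;> simp
  calc ∑ a, (∑ c, (R a c : ℂ) * z c) * (∑ d, (R a d : ℂ) * w d)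
      = ∑ a, ∑ c, ∑ d, (R a c : ℂ) * (R a d : ℂ) * (z c * w d) := by
        refine Finset.sum_congr rfl fun a _ => ?_
        rw [Finset.sum_mul_sum]
        exact Finset.sum_congr rfl fun c _ => Finset.sum_congr rfl fun d _ => by ring
    _ = ∑ c, ∑ d, (∑ a, (R a c : ℂ) * (R a d : ℂ)) * (z c * w d) := by
        rw [Finset.sum_comm]
        refine Finset.sum_congr rfl fun c _ => ?_
        rw [Finset.sum_comm]
        exact Finset.sum_congr rfl fun d _ => by rw [Finset.sum_mul]
    _ = ∑ c, ∑ d, (if c = d then (1 : ℂ) else 0) * (z c * w d) := by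
        refine Finset.sum_congr rfl fun c _ => Finset.sum_congr rfl fun d _ => ?_
        rw [hentry c d]
    _ = ∑ c, z c * w c := by
        refine Finset.sum_congr rfl fun c _ => ?_
        simp only [ite_mul, one_mul, zero_mul, Finset.sum_ite_eq, Finset.mem_univ, if_true]

/-- `Σ_a |Σ_c R_ac z_c|² = Σ_c |z_c|²` for `Rᵀ R = 1` (a real orthogonal `R` preserves the Hermitian norm).
[cite: MagnenRivasseauSeneor1993, §III p.347 tl.19–22] -/
theorem sum_normSq_rotate {R : Matrix (Fin 3) (Fin 3) ℝ} (hR : Rᵀ * R = 1) (z : Fin 3 → ℂ) :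
    ∑ a, normSq (∑ c, (R a c : ℂ) * z c) = ∑ c, normSq (z c) := by
  have hconj : ∀ a, conj (∑ c, (R a c : ℂ) * z c) = ∑ c, (R a c : ℂ) * conj (z c) := by
    intro a
    rw [map_sum]
    exact Finset.sum_congr rfl fun c _ => by rw [map_mul, Complex.conj_ofReal]
  have h := sum_rotate_mul_rotate hR z (fun c => conj (z c))
  apply Complex.ofReal_injective
  push_cast
  simp_rw [← Complex.mul_conj]
  simp_rw [hconj]
  exact h

/-- **`∫_Λ A²` is invariant under global colour rotations.** [cite: MagnenRivasseauSeneor1993, §III p.347 tl.19–25] -/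
theorem opA2_colourRotate {R : Matrix (Fin 3) (Fin 3) ℝ} (hR : Rᵀ * R = 1) (A : Config) :
    opA2 S (colourRotate R A) = opA2 S A := by
  rw [opA2_eq, opA2_eq]
  congr 1
  refine Finset.sum_congr rfl fun p _ => Finset.sum_congr rfl fun μ _ => ?_
  simp_rw [coeff_colourRotate]
  exact sum_normSq_rotate hR _

/-- **`∫_Λ A(−Δ)A` is invariant under global colour rotations.** [cite: MagnenRivasseauSeneor1993, §III p.347 tl.19–25] -/
theorem opALapA_colourRotate {R : Matrix (Fin 3) (Fin 3) ℝ} (hR : Rᵀ * R = 1) (A : Config) :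
    opALapA S (colourRotate R A) = opALapA S A := by
  unfold opALapA quadForm
  congr 1
  refine Finset.sum_congr rfl fun p _ => ?_
  congr 1
  refine Finset.sum_congr rfl fun μ _ => ?_
  simp_rw [coeff_colourRotate]
  exact sum_normSq_rotate hR _

/-- **`∫_Λ (∂A)²` is invariant under global colour rotations** (the rotation commutes with `Σ_μ p_μ ·`).
[cite: MagnenRivasseauSeneor1993, §III p.347 tl.19–25] -/
theorem opDivSq_colourRotate {R : Matrix (Fin 3) (Fin 3) ℝ} (hR : Rᵀ * R = 1) (A : Config) :
    opDivSq S (colourRotate R A) = opDivSq S A := by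
  unfold opDivSq
  congr 1
  refine Finset.sum_congr rfl fun p _ => ?_
  have hcomm : ∀ a, (∑ μ, ((p.1 μ : ℤ) : ℂ) * coeff (colourRotate R A) p μ a) =
      ∑ c, (R a c : ℂ) * (∑ μ, ((p.1 μ : ℤ) : ℂ) * coeff A p μ c) := by
    intro a
    simp_rw [coeff_colourRotate, Finset.mul_sum]
    rw [Finset.sum_comm]
    exact Finset.sum_congr rfl fun c _ => Finset.sum_congr rfl fun μ _ => by ring
  simp_rw [hcomm]
  exact sum_normSq_rotate hR _

/-- The density coefficient `(A²)~(k)` is invariant under global colour rotations.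
[cite: MagnenRivasseauSeneor1993, §III p.347 tl.19–25] -/
theorem sqDensity_colourRotate {R : Matrix (Fin 3) (Fin 3) ℝ} (hR : Rᵀ * R = 1) (A : Config) (k : Fin 4 → ℤ) :
    sqDensity S (colourRotate R A) k = sqDensity S A k := by
  unfold sqDensity
  congr 1
  refine Finset.sum_congr rfl fun q _ => Finset.sum_congr rfl fun r _ => ?_
  split_ifs
  · refine Finset.sum_congr rfl fun μ _ => ?_
    simp_rw [coeff_colourRotate]
    exact sum_rotate_mul_rotate hR _ _
  · rfl

/-- **`∫_Λ A⁴` is invariant under global colour rotations.** [cite: MagnenRivasseauSeneor1993, §III p.347 tl.19–25] -/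
theorem opA4_colourRotate {R : Matrix (Fin 3) (Fin 3) ℝ} (hR : Rᵀ * R = 1) (A : Config) :
    opA4 S (colourRotate R A) = opA4 S A := by
  unfold opA4
  simp_rw [sqDensity_colourRotate S hR]

/-- Special orthogonal matrices qualify (`Rᵀ R = 1`): the four new operators of (III.1) are invariant under the
global `SO(3)` — the adjoint image of the constant `SU(2)` gauge transformations.
[cite: MagnenRivasseauSeneor1993, §III p.347 tl.19–25, (II.4) p.329] -/
theorem ops_invariant_of_mem_specialOrthogonalGroup {R : Matrix (Fin 3) (Fin 3) ℝ}
    (hR : R ∈ Matrix.specialOrthogonalGroup (Fin 3) ℝ) (A : Config) :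
    opA2 S (colourRotate R A) = opA2 S A ∧ opALapA S (colourRotate R A) = opALapA S A ∧
      opDivSq S (colourRotate R A) = opDivSq S A ∧ opA4 S (colourRotate R A) = opA4 S A := by
  have h : Rᵀ * R = 1 := by
    have h1 := (Matrix.mem_specialOrthogonalGroup_iff.mp hR).1
    rw [Matrix.mem_orthogonalGroup_iff'] at h1
    simpa [Matrix.star_eq_conjTranspose] using h1
  exact ⟨opA2_colourRotate S h A, opALapA_colourRotate S h A, opDivSq_colourRotate S h A, opA4_colourRotate S h A⟩

/-! ## §5 (v1.1) The printed wedge product is `SO(3)`-equivariant; `F₄`, the Yang–Mills action (II.2) and the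
whole of `CT_ρ` are invariant under global colour rotations — «This action is invariant under the gauge
transformations» (p.329 tl.4) for the CONSTANT ones, exactly, and p.347 tl.19–22 for all five operators of (III.1) -/

/-- The rotation with complex entries acting on colour vectors: `(R·v)_a = Σ_c R_ac v_c`.
[cite: MagnenRivasseauSeneor1993, (II.4) p.329, §III p.347 tl.19–22] -/
def rotVec (R : Matrix (Fin 3) (Fin 3) ℝ) (v : Fin 3 → ℂ) : Fin 3 → ℂ := fun a => ∑ c, (R a c : ℂ) * v c

/-- `rotVec` is additive. [cite: MagnenRivasseauSeneor1993, §III p.347 tl.19–22] -/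
theorem rotVec_add (R : Matrix (Fin 3) (Fin 3) ℝ) (v w : Fin 3 → ℂ) : rotVec R (v + w) = rotVec R v + rotVec R w := by
  ext a
  simp only [rotVec, Pi.add_apply, mul_add, Finset.sum_add_distrib]

/-- `rotVec` kills `0`. [cite: MagnenRivasseauSeneor1993, §III p.347 tl.19–22] -/
theorem rotVec_zero (R : Matrix (Fin 3) (Fin 3) ℝ) : rotVec R 0 = 0 := by
  ext a
  simp [rotVec]

/-- `rotVec` commutes with complex scalars. [cite: MagnenRivasseauSeneor1993, §III p.347 tl.19–22] -/
theorem rotVec_smul (R : Matrix (Fin 3) (Fin 3) ℝ) (c : ℂ) (v : Fin 3 → ℂ) : rotVec R (c • v) = c • rotVec R v := by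
  ext a
  simp only [rotVec, Pi.smul_apply, smul_eq_mul, Finset.mul_sum]
  exact Finset.sum_congr rfl fun b _ => by ring

/-- `rotVec` commutes with finite sums. [cite: MagnenRivasseauSeneor1993, §III p.347 tl.19–22] -/
theorem rotVec_sum {ι : Type*} (R : Matrix (Fin 3) (Fin 3) ℝ) (T : Finset ι) (v : ι → Fin 3 → ℂ) :
    rotVec R (∑ i ∈ T, v i) = ∑ i ∈ T, rotVec R (v i) := by
  classical
  induction T using Finset.induction_on with
  | empty => simp [rotVec_zero]
  | insert i T hi ih => rw [Finset.sum_insert hi, Finset.sum_insert hi, rotVec_add, ih]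

/-- `rotVec` of an `if`. [cite: MagnenRivasseauSeneor1993, §III p.347 tl.19–22] -/
theorem rotVec_ite (R : Matrix (Fin 3) (Fin 3) ℝ) (P : Prop) [Decidable P] (v : Fin 3 → ℂ) :
    rotVec R (if P then v else 0) = if P then rotVec R v else 0 := by
  split_ifs
  · rfl
  · exact rotVec_zero R

/-- **THE COFACTOR IDENTITY FOR THE PRINTED WEDGE PRODUCT**: for ANY real `3 × 3` matrix `R` and complex colour vectors,
`(R z) ×₃ (R w) = (adjugate R)ᵀ (z ×₃ w)` — a polynomial identity (Mathlib `Matrix.adjugate_fin_three`).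
[cite: MagnenRivasseauSeneor1993, §II.A p.328 tl.32–33] -/
theorem cross_rotVec (R : Matrix (Fin 3) (Fin 3) ℝ) (z w : Fin 3 → ℂ) :
    rotVec R z ⨯₃ rotVec R w = fun a => ∑ c, ((Matrix.adjugate R) c a : ℂ) * (z ⨯₃ w) c := by
  ext a
  fin_cases a <;>
    simp [rotVec, cross_apply, Matrix.adjugate_fin_three, Fin.sum_univ_three] <;> ring

/-- For `Rᵀ R = 1` and `det R = 1` (i.e. `R ∈ SO(3)`) the adjugate is the transpose.
[cite: MagnenRivasseauSeneor1993, §III p.347 tl.19–22] -/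
theorem adjugate_eq_transpose {R : Matrix (Fin 3) (Fin 3) ℝ} (hR : Rᵀ * R = 1) (hdet : R.det = 1) :
    Matrix.adjugate R = Rᵀ := by
  calc Matrix.adjugate R = (Rᵀ * R) * Matrix.adjugate R := by rw [hR, one_mul]
    _ = Rᵀ * (R * Matrix.adjugate R) := by rw [mul_assoc]
    _ = Rᵀ := by rw [Matrix.mul_adjugate, hdet, one_smul, mul_one]

/-- **`SO(3)`-EQUIVARIANCE OF THE WEDGE PRODUCT**: `(R z) ×₃ (R w) = R (z ×₃ w)` for `Rᵀ R = 1`, `det R = 1` — the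
adjoint image of a constant `g ∈ SU(2)` acts by automorphisms of su(2).
[cite: MagnenRivasseauSeneor1993, §II.A p.328 tl.32–33, (II.4) p.329] -/
theorem cross_rotVec_SO {R : Matrix (Fin 3) (Fin 3) ℝ} (hR : Rᵀ * R = 1) (hdet : R.det = 1) (z w : Fin 3 → ℂ) :
    rotVec R z ⨯₃ rotVec R w = rotVec R (z ⨯₃ w) := by
  rw [cross_rotVec, adjugate_eq_transpose hR hdet]
  rfl

/-- The Fourier coefficients of the rotated configuration, as colour vectors: `(R·A)~_μ(p) = R Ã_μ(p)`.
[cite: MagnenRivasseauSeneor1993, (II.4) p.329, §III p.347 tl.19–22] -/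
theorem coeff_colourRotate_vec (R : Matrix (Fin 3) (Fin 3) ℝ) (A : Config) (p : Momentum) (μ : Fin 4) :
    (fun a => coeff (colourRotate R A) p μ a) = rotVec R (fun a => coeff A p μ a) := by
  ext a
  exact coeff_colourRotate R A p μ a

/-- … and the same for the extension by zero `coeffZ`. [cite: MagnenRivasseauSeneor1993, (II.4) p.329] -/
theorem coeffZ_colourRotate (R : Matrix (Fin 3) (Fin 3) ℝ) (A : Config) (k : Fin 4 → ℤ) (μ : Fin 4) (a : Fin 3) :
    coeffZ S (colourRotate R A) k μ a = ∑ c, (R a c : ℂ) * coeffZ S A k μ c := by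
  unfold coeffZ
  split_ifs
  · simp
  · exact coeff_colourRotate R A _ μ a
  · simp

/-- The linear part `(∂ ∧ A)~` rotates: `linCurv(R·A) = R·linCurv(A)`. [cite: MagnenRivasseauSeneor1993, (II.1) p.328, (II.4) p.329] -/
theorem linCurv_colourRotate (R : Matrix (Fin 3) (Fin 3) ℝ) (A : Config) (μ ν : Fin 4) (k : Fin 4 → ℤ) :
    (fun a => linCurv S (colourRotate R A) μ ν a k) = rotVec R (fun a => linCurv S A μ ν a k) := by
  ext a
  simp only [linCurv, rotVec, coeffZ_colourRotate, Finset.mul_sum, ← Finset.sum_sub_distrib]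
  exact Finset.sum_congr rfl fun c _ => by ring

/-- The quadratic part `[A_μ, A_ν]~` rotates for `R ∈ SO(3)`: `quadCurv(R·A) = R·quadCurv(A)` (equivariance of the
wedge product, term by term in the convolution). [cite: MagnenRivasseauSeneor1993, (II.1) p.328 tl.30–33, (II.4) p.329] -/
theorem quadCurv_colourRotate {R : Matrix (Fin 3) (Fin 3) ℝ} (hR : Rᵀ * R = 1) (hdet : R.det = 1) (A : Config)
    (μ ν : Fin 4) (k : Fin 4 → ℤ) :
    quadCurv S (colourRotate R A) μ ν k = rotVec R (quadCurv S A μ ν k) := by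
  unfold quadCurv
  rw [rotVec_sum]
  refine Finset.sum_congr rfl fun q _ => ?_
  rw [rotVec_sum]
  refine Finset.sum_congr rfl fun r _ => ?_
  rw [rotVec_ite, coeff_colourRotate_vec, coeff_colourRotate_vec, cross_rotVec_SO hR hdet]

/-- Hence the full curvature coefficient rotates: `F̃(R·A) = R·F̃(A)` (as colour vectors), every coupling.
[cite: MagnenRivasseauSeneor1993, (II.1) p.328, (II.4) p.329] -/
theorem curvCoeff_colourRotate {R : Matrix (Fin 3) (Fin 3) ℝ} (hR : Rᵀ * R = 1) (hdet : R.det = 1) (lam : ℝ)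
    (A : Config) (μ ν : Fin 4) (k : Fin 4 → ℤ) :
    (fun a => curvCoeff S lam (colourRotate R A) μ ν a k) = rotVec R (fun a => curvCoeff S lam A μ ν a k) := by
  have h1 := linCurv_colourRotate S R A μ ν k
  have h2 := quadCurv_colourRotate S hR hdet A μ ν k
  ext a
  have h1a : linCurv S (colourRotate R A) μ ν a k = rotVec R (fun b => linCurv S A μ ν b k) a := congrFun h1 a
  unfold curvCoeff
  rw [h1a, h2]
  simp only [rotVec, Finset.mul_sum, ← Finset.sum_sub_distrib]
  exact Finset.sum_congr rfl fun c _ => by ring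

/-- **«This action is invariant under the gauge transformations» (p.329 tl.4) for the GLOBAL (constant) ones, exactly:
the cut-off Yang–Mills action (II.2) of `…AxialYMAction` is invariant under `A ↦ R·A`, `R ∈ SO(3)`, for every window
and coupling.** [cite: MagnenRivasseauSeneor1993, (II.2)–(II.4) pp.328–329] -/
theorem action_colourRotate {R : Matrix (Fin 3) (Fin 3) ℝ} (hR : Rᵀ * R = 1) (hdet : R.det = 1) (lam : ℝ)
    (A : Config) : action S lam (colourRotate R A) = action S lam A := by
  unfold action
  refine congrArg (fun x : ℝ => (1 / 4 : ℝ) * x) ?_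
  refine Finset.sum_congr rfl fun k _ => Finset.sum_congr rfl fun μ _ => Finset.sum_congr rfl fun ν _ => ?_
  have h := curvCoeff_colourRotate S hR hdet lam A μ ν k
  have h' : ∀ a, curvCoeff S lam (colourRotate R A) μ ν a k = rotVec R (fun b => curvCoeff S lam A μ ν b k) a :=
    fun a => congrFun h a
  simp_rw [h']
  exact sum_normSq_rotate hR _

/-- **`F₄` is invariant under global `SO(3)`** (the fifth operator of (III.1)). [cite: MagnenRivasseauSeneor1993, (II.3) p.329, §III p.347 tl.19–22] -/
theorem F4_colourRotate {R : Matrix (Fin 3) (Fin 3) ℝ} (hR : Rᵀ * R = 1) (hdet : R.det = 1) (A : Config) :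
    F4 S (colourRotate R A) = F4 S A := by
  unfold F4
  refine congrArg (fun x : ℝ => (1 / 4 : ℝ) * x) ?_
  refine Finset.sum_congr rfl fun k _ => Finset.sum_congr rfl fun μ _ => Finset.sum_congr rfl fun ν _ => ?_
  rw [quadCurv_colourRotate S hR hdet]
  exact sum_normSq_rotate hR _

/-- **The counterterm functional `CT_ρ` of (III.1), and with it the factor `e^{CT_ρ(A′)}` of (II.78), is invariant under
global `SO(3)` colour rotations** — all five operators are (p.347 tl.19–22 «Our ultraviolet cutoff does not break
global SU(2) … invariance»). [cite: MagnenRivasseauSeneor1993, §III (III.1) p.347, p.347 tl.19–22] -/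
theorem counterterm_colourRotate {R : Matrix (Fin 3) (Fin 3) ℝ} (hR : Rᵀ * R = 1) (hdet : R.det = 1)
    (cf : CountertermFamily) (ρ : ℕ) (A : Config) :
    counterterm S cf ρ (colourRotate R A) = counterterm S cf ρ A := by
  unfold counterterm
  rw [opA4_colourRotate S hR, opA2_colourRotate S hR, opALapA_colourRotate S hR, opDivSq_colourRotate S hR,
    F4_colourRotate S hR hdet]

/-- … for `R` in Mathlib's `Matrix.specialOrthogonalGroup (Fin 3) ℝ`. [cite: MagnenRivasseauSeneor1993, §III (III.1) p.347, p.347 tl.19–22] -/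
theorem ctFactor_colourRotate_of_mem_specialOrthogonalGroup {R : Matrix (Fin 3) (Fin 3) ℝ}
    (hR : R ∈ Matrix.specialOrthogonalGroup (Fin 3) ℝ) (cf : CountertermFamily) (ρ : ℕ) (A : Config) :
    ctFactor S cf ρ (colourRotate R A) = ctFactor S cf ρ A := by
  have h := Matrix.mem_specialOrthogonalGroup_iff.mp hR
  have h1 : Rᵀ * R = 1 := by
    have := h.1
    rw [Matrix.mem_orthogonalGroup_iff'] at this
    simpa [Matrix.star_eq_conjTranspose] using this
  unfold ctFactor
  rw [counterterm_colourRotate S h1 h.2]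

end MainStatement

end Literature.MathematicalPhysics.QuantumFieldTheory.MagnenRivasseauSeneor1993
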